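import Literature.MathematicalPhysics.QuantumFieldTheory.Balaban1983to89.B9SupplySockB9P3ZdSkewGaugeMode
import Literature.MathematicalPhysics.QuantumFieldTheory.Balaban1983to89.B9SupplySockB9P3ZdAtHerm

/-!
# `Balaban1983to89.B9SupplySockB9P3ZdSkewGaugeModeCube` — THE ZERO-MODE CERTIFICATES AT EVERY CUBE MEMBER `{□_j}` OF [Balaban1985RegularSpaces] (1.131):
# (§1) the SKEW pure gauge of `B9SupplySockB9P3ZdSkewGaugeMode` at the witness pair `x₀ = Lᵏa`, `x₁ = x₀ + e_κ` (`InvAt` false, every `1 ≤ m ≤ k`, every class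
# avoiding `□₁` at level `0` — the tree's `cubeLamBP'`); (§2) LOCATED-2: even on HERMITIAN fields (EDITION H, `InvAtH`) the genuine `Δ_a(1)` keeps the boundary
# pure gauge `d(𝟙_{Ω₀}·1)` of this lineage's g10 certificate as a zero mode whenever the class's level-`0` bonds are INNER and its higher boxes lie in `Ω₀`
# (`cubeLamBP'`, every `m ≤ k`) — print's (3.16) needs the CROSSING bonds of `Ω₀` at level `0` ([B8] p. 77), as the tree's `cubeLamBP` has them

statement-level skeleton of published theorems with citation tags; proofs where landed; nothing here is a claim about the
Yang–Mills mass gap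

`[Balaban1985RegularSpaces]` ("B8") (1.131) p. 99 (the cubes `□_j ⊃ □_{j+1}`, margins `R₁M₁Lʲη`, p. 98), (1.68) p. 88 (truncated restriction sets), p. 77 *«we denote
by Ω also the set of bonds … at least one end-point of b belongs to Ω»*, (1.38) p. 82, (1.58) p. 86, Prop. 6 p. 99; `[Balaban1985BackgroundPropagators]` ("B9")
(3.16) p. 393 *«Λ₀ = Ω₀^{(0)} ∖ Ω₁^{(0)}»*, (3.20)–(3.22) p. 394, (3.26)–(3.27) p. 395, Thm 3.11 p. 416, p. 391 («hermitian matrices»).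

CITATION HEADER (lean-in-tree rule).  Cell `pub-ymgap` (YM Track A, HUMAN RULING D-0062 ∕ D-0149), node N06 = [B9]; seat `pub-ymgap-dag-n06-b` (g18), binder owner of
the junction J-N06→N05.  Companion of `B9SupplySockB9P3ZdSkewGaugeMode` (p601330) and `B9SupplySockB9P3ZdAtHerm` (p601378, EDITION H), same seat, same day.

§1 (A6 FOR THE SKEW CERTIFICATE).  `…SkewGaugeMode.invAt_opsAllZd_false_of_prop6At` asks for a member with finite `Ω₀`, two sites of `Ω₀` in one `L`-block off
the level-`0` class, and `Prop6At`; at every cube member (`Ω = cubeFam false L a Mc ρ k`, `L ≥ 2`, `Mc, ρ ≥ 1`, `d ≥ 1`) and every `1 ≤ m` these are met by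
`x₀ = Lᵏa` (the lower corner of the blown-up unit box, two lattice steps inside `□₁`) and `x₁ = x₀ + e_κ`, for every class whose level-`0` bonds avoid `□₁` — the
tree's `cubeLamBP'` ∕ `cubeLamB` (both end-points in `Λ_s m 0 = □₀ ∖ □₁`).

§2 (LOCATED-2: THE HERMITIAN BOUNDARY MODE AT THE OBJECT LAYER).  EDITION H removes the skew modes; it does NOT remove this lineage's g10 boundary mode
`g = d(𝟙_{Ω₀}·1)` (Hermitian!) when the datum class has no level-`0` CROSSING bonds: `D*Dg = 0` (closed), `Δ′(1) = 0`, `D R(1) 𝟙_{Ω₀}D*g = 0` because `g` is in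
the Landau gauge OF RECORD under the margin (1.5) (`B9SupplySockB9P3ZdAtBoundaryMode.isLandau138_one_grad_indicator` + w4's `landauAt_opsAllZd` — the genuine
`R(1)` kills it too), and `Q*aQ(1)g = 0` because `g` vanishes on inner bonds and has equal `Lʲ`-block sums on the two blocks of every higher class bond lying
in `Ω₀` (`…SkewGaugeMode.linCovIter_one_grad_alg`).  Hence `InvAtH` is FALSE at such members on the `Prop6At` road (★★★ `invAtH_opsAllZd_false_of_boundaryMode`),
in particular at EVERY cube member with the split class `cubeLamBP'` and EVERY `m ≤ k` (★★★ `cube_invAtH_opsAllZd_false_cubeLamBP'`).  CURE (print's): the class of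
the genuine letter must contain the crossing bonds of `Ω₀` at level `0` — [B8] p. 77 bond convention, [B9] (3.16) with `Λ₀ ⊇ ∂Ω₀`; the tree's `cubeLamBP`
(n05-c, `cubeLamBP_zero_bondTouches`) has them (`g` is then seen: `Q₀g = g = −1` on a crossing bond), `cubeLamBP'` (the split edition made for the LETTER road's
`|B₁|`-index bookkeeping) does not.  For the junction: EDITION H (`InvAtH`) + a class WITH level-`0` crossing bonds are BOTH necessary before Theorem 3.11 can
hold at a member for the genuine record; whether they suffice at `U₀ = 1` is IDEA-3.11 step (i)_𝔤 (flat positivity on `E_𝔤(Ω₀)`), NOT proved here.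

WHAT IS PROVED (kernel, 0 sorry; theorems only; no `instance`, no `notation`).
* §1 `cubeLamB_zero_mem` · `not_mem_cubeLamS_zero_of_mem_cube_one` · `near_corner_mem_cube_one` · `blockMap_corner_eq` · ★★★ `cube_invAt_opsAllZd_false` (any class
  avoiding `□₁` at level `0`) · ★★★ `cube_invAt_opsAllZd_false_cubeLamBP'`.
* §2 `QQZdP_eq_zero_of_clsField_eq_zero` · `inBox_loK_bondHiK_of_boxVec` · ★★★ `invAtH_opsAllZd_false_of_boundaryMode` (generic member: finite `Ω₀`, boundary bond,
  margin, level-`0` bonds inner, higher boxes in `Ω₀`, `Prop6At`) · ★★★ `cube_invAtH_opsAllZd_false_cubeLamBP'` (every cube member, `ρ ≥ max 2 L`, every `m ≤ k`).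

HONEST SCOPE.  Bookkeeping over landed certificates; nothing landed is false (the knits over `cubeLamBP'` with `hinv` at `opsAllZd` are TRUE with an
uninhabitable hypothesis); count-neutral; nothing of [B9] Thm 3.3 ∕ 3.11 proved; N05 ∕ N06 NOT discharged; K1⁷ `stmt-QuantumFields-20542` NOT closed; 28∕28 · 5∕27
UNMOVED; one finite `𝕋⁴` programme at fixed `ε`, Bałaban as printed; nothing continuum ∕ ℝ⁴ ∕ OS ∕ mass gap ∕ Clay — R4 closes the conditional finite-`𝕋⁴` rung
`BalabanLadder.UV` only.  Unit `pub-ymgap-dag-n06-b` (g18), 2026-08-28.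
-/

noncomputable section

namespace Literature.MathematicalPhysics.QuantumFieldTheory.Balaban1983to89.B9SupplySockB9P3ZdSkewGaugeModeCube

open B7Prop1Explicit
open B7Prop1Local (InBox)
open B7Prop2Explicit (unitaryUnits)
open B8LeafModelZd (ZdIdx)
open B9SupplySockB9P3ZdLetters (OpsZd)
open B9SupplySockB9P3ZdAt (InvAt Prop6At)
open B8Eq131Cubes (cube bLo bHi cube_eq cube_anti gs one_le_gs)
open B8Eq131CubesAdmissible (cubeFam cubeFam_false_zero)
open B8CubeMemberZd (cubeLamS cubeLamB cubeLamS_of_lt mem_cubeLam_zero_iff)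
open B9SupplySockB9P3ZdGamma (cubeLamBP' cubeLamBP'_zero)
open B9SupplySockB9P3ZdAllLettersZd (opsAllZd)
open B9SupplySockB9P3ZdSkewGaugeMode (skewMode skewMode_eq_zero_of_ne invAt_opsAllZd_false_of_prop6At linCovIter_one_grad_alg linCovIterT_zero_field
  one_mem_unitaryUnits_cfg)
open B9SupplySockB9P3ZdAtHerm (InvAtH)
open B7Prop1Local (loK bondHiK)
open B7Prop4GeneralLevels (linCovIter linCovIter_zero)
open B8Ineq132 (BondTouches)
open B8Eq146AExpansion (iEta)
open B8Eq155JBound (Jcur)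
open B8Eq140Level (SideTouches)
open B8ScaledSupNorm (weight Bdd)
open B9SupplySockB9P3ZdLetters (deltaAOf)
open B9SupplySockB9P3ZdLettersOmega (OnDom)
open B9SupplySockB9P3ZdAtBoundaryMode (Jcur_one_grad weight_negOne_mono exists_small_window isLandau138_one_grad_indicator cube_deep
  cube_corner_boundary_bond)
open B9Eq369CurvSmallZd (DpZd_one)
open B9Eq316AveragingTransposeZd (clsField linCovIterT wQ Reg17 alphaQ)
open B9Eq316AveragingTransposeZdPrinted (QQZdP QQZdP_of_reg17 QQZdP_of_not_reg17)
open B9SupplySockB9P3ZdAllLettersZd (opsAllZd_Dp opsAllZd_QQ landauAt_opsAllZd)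
open B8Ineq159FlatCubeMemberPrinted (cubeLamBP cubeLamBP_box_subset_pred)
open B9SupplySockB9P3ZdGamma (cubeLamBP'_of_ne_zero)
open Literature.MathematicalPhysics.QuantumLattice (blockMap blockSites)

export B7Prop1Explicit (Site)

variable {d : ℕ} {𝔸 : Type*} [CStarAlgebra 𝔸]

section Cube

variable {L : ℕ}

/-- **A LEVEL-0 BOND OF THE CUBE CLASS HAS BOTH END-POINTS IN `Λ_s m 0`** (`cubeLamB … m 0`: at `j = 0` only the first disjunct of the class law can hold).
[cite: Balaban1985RegularSpaces, (1.131) p.99, (1.68) p.88; Balaban1984PropagatorsII, (2.3) p.224] -/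
theorem cubeLamB_zero_mem {a : Site d} {Mc ρ k m : ℕ} {p : Site d × Fin d} (hp : p ∈ cubeLamB L a Mc ρ k m 0) :
    p.1 ∈ cubeLamS L a Mc ρ k m 0 ∧ p.1 + e p.2 ∈ cubeLamS L a Mc ρ k m 0 := by
  rcases hp.2 with h | ⟨j', hj', _⟩ | ⟨j', hj', _⟩
  · exact h
  · exact absurd hj' (by omega)
  · exact absurd hj' (by omega)

/-- **FOR `m ≥ 1` NO SITE OF `□₁` LIES IN `Λ_s m 0 = □₀ ∖ □₁`.** [cite: Balaban1985RegularSpaces, (1.131) p.99, (1.68) p.88] -/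
theorem not_mem_cubeLamS_zero_of_mem_cube_one (hL : 1 ≤ L) {a : Site d} {Mc ρ k m : ℕ} (hk : 1 ≤ k) (hm : 1 ≤ m) {x : Site d}
    (hx : x ∈ cube L a Mc ρ k 1) : x ∉ cubeLamS L a Mc ρ k m 0 := by
  rw [cubeLamS_of_lt L a Mc ρ k (show 0 < m from hm), mem_cubeLam_zero_iff hL a Mc ρ hk]
  exact fun h => h.2 hx

/-- **THE WITNESS PAIR INSIDE `□₁`**: every site within ℓ∞-distance `2` of the lower corner `x₀ = Lᵏ·a` of the blown-up unit box lies in `□₁` (the box sits inside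
`□₁` with margin `L·R₁M₁·Σ_{i<k} Lⁱ ≥ 2`). [cite: Balaban1985RegularSpaces, p.98 («a distance between boundaries of these cubes is equal to R₁M₁Lʲη»), (1.131) p.99] -/
theorem near_corner_mem_cube_one (hL : 2 ≤ L) (a : Site d) {Mc ρ k : ℕ} (hMc : 1 ≤ Mc) (hρ : 1 ≤ ρ) (hk : 1 ≤ k) {y : Site d}
    (hy : ∀ n, bLo L a k 0 n - 2 ≤ y n ∧ y n ≤ bLo L a k 0 n + 2) : y ∈ cube L a Mc ρ k 1 := by
  rw [cube_eq hk]
  intro n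
  obtain ⟨h1, h2⟩ := hy n
  have hmar : (2 : ℤ) ≤ (L : ℤ) ^ 1 * ((ρ : ℤ) * ((gs L (k - 1) : ℕ) : ℤ)) := by
    have h := Nat.mul_le_mul hL (Nat.mul_le_mul hρ (one_le_gs L (k - 1)))
    rw [pow_one]; exact_mod_cast h
  have hLk : (1 : ℤ) ≤ (L : ℤ) ^ k := by exact_mod_cast Nat.one_le_pow k L (by omega)
  have hMc' : (1 : ℤ) ≤ Mc := by exact_mod_cast hMc
  simp only [bLo, bHi, Nat.cast_zero, sub_zero] at h1 h2 ⊢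
  have hprod : (L : ℤ) ^ k * (a n + Mc) = (L : ℤ) ^ k * a n + (L : ℤ) ^ k * Mc := mul_add _ _ _
  have hge : (L : ℤ) ^ k ≤ (L : ℤ) ^ k * Mc := le_mul_of_one_le_right (by positivity) hMc'
  push_cast
  constructor <;> linarith

/-- **`x₀ = Lᵏ·a` AND `x₀ + e_κ` LIE IN ONE `L`-BLOCK** (`k ≥ 1`, `L ≥ 2`: the coordinates of `x₀` are multiples of `L`). [cite: Balaban1985Averaging, (3) p.17 (blocks)] -/
theorem blockMap_corner_eq (hL : 2 ≤ L) (a : Site d) {k : ℕ} (hk : 1 ≤ k) (κ : Fin d) :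
    blockMap L (bLo L a k 0) = blockMap L (bLo L a k 0 + e κ) := by
  funext n
  simp only [blockMap, bLo, Nat.cast_zero, sub_zero, Pi.add_apply, e_apply]
  obtain ⟨k', rfl⟩ := Nat.exists_eq_add_of_le hk
  have hL0 : (0 : ℤ) < L := by exact_mod_cast (show 0 < L by omega)
  split_ifs with h
  · have hq : (L : ℤ) ^ (1 + k') * a n = (L : ℤ) * ((L : ℤ) ^ k' * a n) := by ring
    rw [hq, Int.mul_ediv_cancel_left _ hL0.ne', add_comm, Int.add_mul_ediv_left _ _ hL0.ne']
    have : (1 : ℤ) / (L : ℤ) = 0 := Int.ediv_eq_zero_of_lt (by norm_num) (by exact_mod_cast hL)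
    rw [this, zero_add]
  · rw [add_zero]

variable [FiniteDimensional ℝ 𝔸] (τ : 𝔸 →ₗ[ℂ] ℂ)
variable {I : Type} (bg : I → B9.Backgrounds) (mem : ℝ → ZdIdx d L → ℕ → I)
variable (ιCfg : ∀ (M : ℝ) (i : ZdIdx d L) (m : ℕ) (U₀ : Site d → Fin d → 𝔸ˣ), (∀ x κ, U₀ x κ ∈ unitaryUnits 𝔸) → (bg (mem M i m)).Cfg)

/-- ★★★ **AT EVERY CUBE MEMBER `{□_j}` OF (1.131) AND EVERY TRUNCATION `1 ≤ m ≤ k`, `InvAt` FOR THE FOUR-LETTER RECORD IS FALSE ON THE `Prop6At` ROAD** — for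
EVERY datum class `ΛbP` whose level-`0` bonds avoid the interior cube `□₁` (print's live on `Λ₀ = □₀ ∖ □₁` and its boundary; the tree's: next theorem): member data
`Ω = cubeFam false L a Mc ρ k`, `L ≥ 2`, `Mc, ρ ≥ 1`, `d ≥ 1`; fibre with a skew-Hermitian `c ≠ 0` and a faithful Hermitian tracial `τ`; `0 < c₆, K₆, a₃`; witness
pair `x₀ = Lᵏa`, `x₁ = x₀ + e_κ`. [cite: Balaban1985RegularSpaces, (1.131) p.99, (1.68) p.88, Prop. 6 p.99, (1.58) p.86; Balaban1985BackgroundPropagators, (3.27) p.395, Thm 3.11 p.416, p.391] -/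
theorem cube_invAt_opsAllZd_false [Nontrivial 𝔸] (hτt : ∀ a b : 𝔸, τ (a * b) = τ (b * a))
    (hτs : ∀ a : 𝔸, τ (star a) = starRingEnd ℂ (τ a)) (hτp : ∀ a : 𝔸, a ≠ 0 → 0 < (τ (star a * a)).re)
    (hL : 2 ≤ L) (ops₀ : ℝ → ZdIdx d L → ℕ → OpsZd d 𝔸) {c35 c₆ K₆ a₃ M : ℝ} (hc₆ : 0 < c₆) (hK₆ : 0 < K₆) (ha₃ : 0 < a₃)
    {c : 𝔸} (hc : star c = -c) (hc0 : c ≠ 0) (κ : Fin d)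
    (i : ZdIdx d L) {a : Site d} {Mc ρ : ℕ} (hMc : 1 ≤ Mc) (hρ : 1 ≤ ρ)
    (hΩ : i.Ω = cubeFam false L a Mc ρ i.k) {m : ℕ}
    (ΛbP : ℕ → ℕ → Set (Site d × Fin d)) (hcls0 : ∀ p ∈ ΛbP m 0, ¬ (p.1 ∈ cube L a Mc ρ i.k 1 ∧ p.1 + e p.2 ∈ cube L a Mc ρ i.k 1))
    (hP6 : Prop6At bg L mem ιCfg c35 c₆ K₆ M i m) :
    ¬ InvAt bg L mem ιCfg (opsAllZd τ L ΛbP ops₀) c35 a₃ M i m := by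
  have hL1 : 1 ≤ L := le_trans (by norm_num) hL
  have hk := i.hk
  -- the member's `Ω₀ = □₀` is a finite box and contains `□₁`
  have hΩ0 : i.Ω 0 = cube L a Mc ρ i.k 0 := by rw [hΩ, cubeFam_false_zero]
  have hfin : (i.Ω 0).Finite := by
    rw [hΩ0, cube_eq (Nat.zero_le _)]
    refine (Set.finite_Icc (bLo L a i.k (L ^ 0 * (ρ * gs L (i.k - 0)))) (bHi L a Mc i.k (L ^ 0 * (ρ * gs L (i.k - 0))))).subset
      fun x hx => ?_
    exact ⟨fun n => (hx n).1, fun n => (hx n).2⟩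
  have h10 : cube L a Mc ρ i.k 1 ⊆ i.Ω 0 := by rw [hΩ0]; exact cube_anti (Nat.zero_le 1) hk
  -- the witness pair and its neighbours
  set x₀ : Site d := bLo L a i.k 0 with hx₀
  have hnear : ∀ y : Site d, (∀ n, x₀ n - 2 ≤ y n ∧ y n ≤ x₀ n + 2) → y ∈ cube L a Mc ρ i.k 1 :=
    fun y hy => near_corner_mem_cube_one hL a hMc hρ hk hy
  have he : ∀ (μ : Fin d) (n : Fin d), 0 ≤ e μ n ∧ e μ n ≤ 1 := by
    intro μ n; rw [e_apply]; split_ifs <;> constructor <;> norm_num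
  have hx₀in : x₀ ∈ cube L a Mc ρ i.k 1 := hnear x₀ fun n => by constructor <;> linarith
  have hadd : ∀ μ : Fin d, x₀ + e μ ∈ cube L a Mc ρ i.k 1 := fun μ => hnear _ fun n => by
    have hy : (x₀ + e μ) n = x₀ n + e μ n := rfl
    rw [hy]; constructor <;> linarith [(he μ n).1, (he μ n).2]
  have hsub : ∀ μ : Fin d, x₀ - e μ ∈ cube L a Mc ρ i.k 1 := fun μ => hnear _ fun n => by
    have hy : (x₀ - e μ) n = x₀ n - e μ n := rfl
    rw [hy]; constructor <;> linarith [(he μ n).1, (he μ n).2]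
  have haddadd : ∀ μ ν : Fin d, x₀ + e μ + e ν ∈ cube L a Mc ρ i.k 1 := fun μ ν => hnear _ fun n => by
    have hy : (x₀ + e μ + e ν) n = x₀ n + e μ n + e ν n := rfl
    rw [hy]; constructor <;> linarith [(he μ n).1, (he μ n).2, (he ν n).1, (he ν n).2]
  have haddsub : ∀ μ ν : Fin d, x₀ + e μ - e ν ∈ cube L a Mc ρ i.k 1 := fun μ ν => hnear _ fun n => by
    have hy : (x₀ + e μ - e ν) n = x₀ n + e μ n - e ν n := rfl
    rw [hy]; constructor <;> linarith [(he μ n).1, (he μ n).2, (he ν n).1, (he ν n).2]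
  have hne : x₀ ≠ x₀ + e κ := by
    intro h; have := congrFun h κ; simp [e_apply] at this
  -- level-0 class bonds avoid the pair: any bond touching {x₀, x₁} has both end-points in □₁
  have hfree : ∀ p ∈ ΛbP m 0, skewMode c x₀ (x₀ + e κ) p.1 p.2 = 0 := by
    intro p hp
    have hnot := hcls0 p hp
    refine skewMode_eq_zero_of_ne c x₀ (x₀ + e κ) ?_ ?_ ?_ ?_
    · rintro h; exact hnot (by rw [h]; exact ⟨hx₀in, hadd p.2⟩)
    · rintro h; exact hnot (by rw [h]; exact ⟨hadd κ, haddadd κ p.2⟩)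
    · intro h
      have hp1 : p.1 = x₀ - e p.2 := eq_sub_of_add_eq h
      exact hnot ⟨by rw [hp1]; exact hsub p.2, by rw [h]; exact hx₀in⟩
    · intro h
      have hp1 : p.1 = x₀ + e κ - e p.2 := eq_sub_of_add_eq h
      exact hnot ⟨by rw [hp1]; exact haddsub κ p.2, by rw [h]; exact hadd κ⟩
  exact invAt_opsAllZd_false_of_prop6At τ bg mem ιCfg hτt hτs hτp hL1 ΛbP ops₀ hc₆ hK₆ ha₃ hfin hP6 hc hc0 hne (h10 hx₀in) (h10 (hadd κ))
    (blockMap_corner_eq hL a hk κ) hfree κ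

/-- ★★★ **THE SAME AT THE TREE'S CUBE CLASS `cubeLamBP'` (dag-n05-e's γ road; its level `0` is `cubeLamB … m 0`)**: those level-`0` bonds have both end-points in
`Λ_s m 0 = □₀ ∖ □₁` (`cubeLamB_zero_mem`), hence avoid `□₁` — so at EVERY cube member and EVERY `1 ≤ m ≤ k`, `¬ InvAt … (opsAllZd τ L (cubeLamBP' L a Mc ρ k) ops₀) … M i m`
on the `Prop6At` road. [cite: Balaban1985RegularSpaces, (1.131) p.99, (1.68) p.88, Prop. 6 p.99; Balaban1985BackgroundPropagators, (3.27) p.395, Thm 3.11 p.416; Balaban1984PropagatorsII, (2.3) p.224] -/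
theorem cube_invAt_opsAllZd_false_cubeLamBP' [Nontrivial 𝔸] (hτt : ∀ a b : 𝔸, τ (a * b) = τ (b * a))
    (hτs : ∀ a : 𝔸, τ (star a) = starRingEnd ℂ (τ a)) (hτp : ∀ a : 𝔸, a ≠ 0 → 0 < (τ (star a * a)).re)
    (hL : 2 ≤ L) (ops₀ : ℝ → ZdIdx d L → ℕ → OpsZd d 𝔸) {c35 c₆ K₆ a₃ M : ℝ} (hc₆ : 0 < c₆) (hK₆ : 0 < K₆) (ha₃ : 0 < a₃)
    {c : 𝔸} (hc : star c = -c) (hc0 : c ≠ 0) (κ : Fin d)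
    (i : ZdIdx d L) {a : Site d} {Mc ρ : ℕ} (hMc : 1 ≤ Mc) (hρ : 1 ≤ ρ)
    (hΩ : i.Ω = cubeFam false L a Mc ρ i.k) {m : ℕ} (hm1 : 1 ≤ m)
    (hP6 : Prop6At bg L mem ιCfg c35 c₆ K₆ M i m) :
    ¬ InvAt bg L mem ιCfg (opsAllZd τ L (cubeLamBP' L a Mc ρ i.k) ops₀) c35 a₃ M i m := by
  have hL1 : 1 ≤ L := le_trans (by norm_num) hL
  refine cube_invAt_opsAllZd_false τ bg mem ιCfg hτt hτs hτp hL ops₀ hc₆ hK₆ ha₃ hc hc0 κ i hMc hρ hΩ _ (fun p hp h => ?_) hP6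
  rw [cubeLamBP'_zero] at hp
  exact not_mem_cubeLamS_zero_of_mem_cube_one hL1 i.hk hm1 h.1 (cubeLamB_zero_mem hp).1

end Cube

/-! ## §2 EDITION H IS NOT ENOUGH WITHOUT PRINT'S LEVEL-0 CROSSING BONDS: the Hermitian boundary pure gauge `d(𝟙_{Ω₀}·1)` is a zero mode of `Δ_a(1)`
whenever the class's level-`0` bonds are INNER and its higher-level boxes lie in `Ω₀` (the tree's `cubeLamBP'`) -/

section BoundaryMode

variable {L : ℕ}

/-- `Q*aQ = 0` as soon as every class input `𝟙_{Λ_j}·LʲηQ_j(U₀)A` vanishes (the letter `QQZdP` is a weighted transpose of those inputs).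
[cite: Balaban1985BackgroundPropagators, (3.16) p.393] -/
theorem QQZdP_eq_zero_of_clsField_eq_zero [FiniteDimensional ℝ 𝔸] (τ : 𝔸 →ₗ[ℂ] ℂ) (ΛbP : ℕ → ℕ → Set (Site d × Fin d)) (i : ZdIdx d L) (m : ℕ)
    (U₀ : Site d → Fin d → 𝔸ˣ) {A : Site d → Fin d → 𝔸} (h : ∀ j, clsField L ΛbP i.η m j U₀ A = 0) :
    QQZdP τ L ΛbP i m U₀ A = 0 := by
  funext y μ
  by_cases hreg : Reg17 L m i.Ω (alphaQ d L / (L : ℝ) ^ 2) U₀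
  · rw [QQZdP_of_reg17 τ L hreg, Pi.zero_apply, Pi.zero_apply]
    refine Finset.sum_eq_zero fun j _ => ?_
    rw [h j, linCovIterT_zero_field, smul_zero]
  · rw [QQZdP_of_not_reg17 τ L hreg]; rfl

/-- **THE SITES OF THE TWO BLOCKS OF A LEVEL-`j` BOND LIE IN ITS BOX `[Lʲz, Lʲz + (Lʲ−1)𝟙 + Lʲe_κ]`** (for the box-sum form `Σ_r g(Lʲw + r)` of the block sums).
[cite: Balaban1985Averaging, p.24 (the box of a block bond)] -/
theorem inBox_loK_bondHiK_of_boxVec (N : ℕ) {L : ℕ} {j : ℕ} (hNj : (N : ℤ) = (L : ℤ) ^ j) (z : Site d) (κ : Fin d)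
    (r : Fin d → Fin N) {w : Site d} (hw : w = z ∨ w = z + e κ) :
    B7Prop1Local.InBox (loK L j z) (bondHiK L j z κ) ((N : ℤ) • w + boxVec N r) := by
  intro n
  have hr0 : (0 : ℤ) ≤ boxVec N r n := by simp [boxVec]
  have hr1 : boxVec N r n + 1 ≤ N := by
    have := (r n).isLt
    simp only [boxVec]; omega
  have hN0 : (0 : ℤ) ≤ N := by exact_mod_cast Nat.zero_le N
  simp only [loK, bondHiK, Pi.add_apply, Pi.smul_apply, smul_eq_mul, ← hNj]
  rcases hw with rfl | rfl
  · split_ifs <;> constructor <;> nlinarith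
  · simp only [Pi.add_apply, e_apply, mul_add]
    split_ifs <;> constructor <;> nlinarith

variable [FiniteDimensional ℝ 𝔸] (τ : 𝔸 →ₗ[ℂ] ℂ)
variable {I : Type} (bg : I → B9.Backgrounds) (mem : ℝ → ZdIdx d L → ℕ → I)
variable (ιCfg : ∀ (M : ℝ) (i : ZdIdx d L) (m : ℕ) (U₀ : Site d → Fin d → 𝔸ˣ), (∀ x κ, U₀ x κ ∈ unitaryUnits 𝔸) → (bg (mem M i m)).Cfg)

/-- ★★★ **EVEN ON HERMITIAN FIELDS, `InvAt` FAILS WHEN THE CLASS MISSES PRINT'S LEVEL-0 CROSSING BONDS.**  At a member `(M, i, m)` with finite `Ω₀`, a boundary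
bond `⟨x₀, x₀ + e_μ⟩` (`x₀ ∈ Ω₀ ∌ x₀ + e_μ`), the margin «every site of `Ω₀` off `Λ_s m 0` has its ℓ∞-2-neighbourhood in `Ω₀`» ((1.5); cubes: `R₁M₁ ≥ 2`), and a datum
class whose level-`0` bonds are INNER (both end-points in `Ω₀`) and whose level-`j ≥ 1` bond boxes lie in `Ω₀` (the tree's law `ZdIdx.hbox` ∕ `SeesDom`'s first
disjunct ∕ `cubeLamBP'`), the HERMITIAN pure gauge `g := d(𝟙_{Ω₀}·1) ≠ 0` of this lineage's g10 certificate (`B9SupplySockB9P3ZdAtBoundaryMode`) is a zero mode of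
the GENUINE four-letter `Δ_a(1)`: `D*Dg = 0` (closed), `Δ′(1) = 0`, `D R(1) 𝟙_{Ω₀}D*g = 0` because `g` is in the Landau gauge OF RECORD
(`isLandau138_one_grad_indicator` + w4's `landauAt_opsAllZd`), `Q*aQ(1)g = 0` because `g` vanishes on the inner bonds and its `Lʲ`-block sums are equal on the two
blocks of every higher class bond (both inside `Ω₀`).  Hence EDITION H's `InvAtH` is FALSE there on the `Prop6At` road: the Hermitian clause is necessary
(`B9SupplySockB9P3ZdSkewGaugeMode`) but NOT sufficient — the class must carry the crossing bonds of `Ω₀` at level `0` ([B8] p. 77 «at least one end-point of b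
belongs to Ω»; this lineage's g10 PRINT READING of (3.16)), as print's (3.16) does and the tree's `cubeLamBP` does (`cubeLamBP_zero_bondTouches`), while
`cubeLamBP'` does not. [cite: Balaban1985BackgroundPropagators, (3.16) p.393, (3.26)–(3.27) p.395, (3.20)–(3.22) p.394, Thm 3.11 p.416; Balaban1985RegularSpaces, p.77 (bond convention), (1.38) p.82, (1.58) p.86, (1.5) p.77] -/
theorem invAtH_opsAllZd_false_of_boundaryMode [NeZero L] [Nontrivial 𝔸] (hτt : ∀ a b : 𝔸, τ (a * b) = τ (b * a))
    (hτs : ∀ a : 𝔸, τ (star a) = starRingEnd ℂ (τ a)) (hτp : ∀ a : 𝔸, a ≠ 0 → 0 < (τ (star a * a)).re)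
    (hL : 1 ≤ L) (ΛbP : ℕ → ℕ → Set (Site d × Fin d)) (ops₀ : ℝ → ZdIdx d L → ℕ → OpsZd d 𝔸) {c35 c₆ K₆ a₃ M : ℝ}
    (hc₆ : 0 < c₆) (hK₆ : 0 < K₆) (ha₃ : 0 < a₃) {i : ZdIdx d L} {m : ℕ} (hΩ : (i.Ω 0).Finite)
    (hdeep : ∀ x ∈ i.Ω 0, x ∉ i.Λs m 0 → ∀ y : Site d, (∀ n, x n - 2 ≤ y n ∧ y n ≤ x n + 2) → y ∈ i.Ω 0)
    {x₀ : Site d} {μ₀ : Fin d} (hx₀ : x₀ ∈ i.Ω 0) (hx₁ : x₀ + e μ₀ ∉ i.Ω 0)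
    (hcls0 : ∀ p ∈ ΛbP m 0, p.1 ∈ i.Ω 0 ∧ p.1 + e p.2 ∈ i.Ω 0)
    (hclsj : ∀ j, 1 ≤ j → ∀ p ∈ ΛbP m j, ∀ x, B7Prop1Local.InBox (loK L j p.1) (bondHiK L j p.1 p.2) x → x ∈ i.Ω 0)
    (hP6 : Prop6At bg L mem ιCfg c35 c₆ K₆ M i m) :
    ¬ InvAtH bg L mem ιCfg (opsAllZd τ L ΛbP ops₀) c35 a₃ M i m := by
  classical
  intro hinv
  have hη : 0 < i.η := i.hη
  obtain ⟨ε, hε, hεP⟩ := exists_small_window hc₆ hK₆ ha₃ M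
  have hreg := hP6 ε 1 one_mem_unitaryUnits_cfg hε (hεP ε hε le_rfl).1 (B8Prop6OfThm4.one_inAk hL m hη hε i.Ω)
  -- the Hermitian boundary pure-gauge mode
  set lam : Site d → 𝔸 := (i.Ω 0).indicator (fun _ => (1 : 𝔸)) with hlam
  set g : Site d → Fin d → 𝔸 := fun x μ => lam (x + e μ) - lam x with hg
  have hlam_le : ∀ x, ‖lam x‖ ≤ ‖(1 : 𝔸)‖ := fun x => norm_indicator_le_norm_self _ _
  have hlam_sa : ∀ x, IsSelfAdjoint (lam x) := by
    intro x; simp only [hlam, Set.indicator]; split_ifs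
    exacts [IsSelfAdjoint.one _, IsSelfAdjoint.zero _]
  have hg_sa : ∀ y τ', IsSelfAdjoint (g y τ') := fun y τ' => (hlam_sa _).sub (hlam_sa _)
  have hg_in : ∀ (y : Site d) (τ' : Fin d), y ∈ i.Ω 0 → y + e τ' ∈ i.Ω 0 → g y τ' = 0 := by
    intro y τ' h1 h2
    simp [hg, hlam, Set.indicator_of_mem h1, Set.indicator_of_mem h2]
  have hgOn : OnDom L m i.η i.Ω g := by
    refine ⟨fun y τ' h => ?_, weight L i.η (-(1 : ℝ)) m * (‖(1 : 𝔸)‖ + ‖(1 : 𝔸)‖), fun j hj b _ => ?_⟩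
    · simp only [BondTouches, not_or] at h
      simp [hg, hlam, Set.indicator_of_notMem h.1, Set.indicator_of_notMem h.2]
    · refine mul_le_mul (weight_negOne_mono hL hη.le hj) ?_ (norm_nonneg _) (B8ScaledSupNorm.weight_nonneg L hη.le _ _)
      exact (norm_sub_le _ _).trans (add_le_add (hlam_le _) (hlam_le _))
  have h0On : OnDom L m i.η i.Ω (0 : Site d → Fin d → 𝔸) := ⟨fun _ _ _ => rfl, 0, fun j _ b _ => by simp⟩
  -- the four genuine letters vanish on `g` at `U₀ = 1`
  have hDR : ∀ (x : Site d) (μ : Fin d), (opsAllZd τ L ΛbP ops₀ M i m).DRDs 1 g x μ = 0 :=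
    landauAt_opsAllZd τ L ΛbP ops₀ M i m (bg := bg) (mem := mem) (ιCfg := ιCfg) hτt hτs hτp c35 a₃ hΩ (K₆ * ε) 1 one_mem_unitaryUnits_cfg
      (mul_pos hK₆ hε) (hεP ε hε le_rfl).2 hreg g hgOn (isLandau138_one_grad_indicator L m i.η hdeep)
  have hcls : ∀ j, clsField L ΛbP i.η m j (1 : Site d → Fin d → 𝔸ˣ) g = 0 := by
    intro j
    funext z κ
    simp only [clsField, Pi.zero_apply]
    split_ifs with hmem
    · have hi' : iEta i.η g = fun y τ' => ((Complex.I : ℂ) * i.η) • (lam (y + e τ') - lam y) := rfl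
      rcases Nat.eq_zero_or_pos j with rfl | hj
      · have hz := hg_in z κ (hcls0 _ hmem).1 (hcls0 _ hmem).2
        simp only [hg] at hz
        rw [linCovIter_zero, hi']
        simp only [hz, smul_zero]
      · rw [hi', linCovIter_one_grad_alg hL _ hlam_le j z κ]
        -- both `Lʲ`-blocks of the class bond lie in `Ω₀`: their sums of `𝟙_{Ω₀}` agree
        have hNj : ((L ^ j : ℕ) : ℤ) = (L : ℤ) ^ j := by push_cast; rfl
        have hsum : ∀ w : Site d, (w = z ∨ w = z + e κ) → ∑ x ∈ blockSites (L ^ j) w, lam x = ∑ _r : Fin d → Fin (L ^ j), (1 : 𝔸) := by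
          intro w hw
          rw [B7Eq214FlatQprime.sum_blockSites_eq_sum_boxVec (L ^ j) w lam]
          refine Finset.sum_congr rfl fun r _ => ?_
          have hx : (((L ^ j : ℕ) : ℤ) • w + boxVec (L ^ j) r) ∈ i.Ω 0 :=
            hclsj j hj (z, κ) hmem _ (inBox_loK_bondHiK_of_boxVec (L ^ j) hNj z κ r hw)
          rw [hlam, Set.indicator_of_mem hx]
        rw [hsum _ (Or.inr rfl), hsum _ (Or.inl rfl), sub_self, smul_zero, smul_zero, smul_zero]
    · rfl
  have hΔ : ∀ (y : Site d) (τ' : Fin d), deltaAOf i.η (opsAllZd τ L ΛbP ops₀ M i m) 1 g y τ' = 0 := by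
    intro y τ'
    rw [deltaAOf, opsAllZd_Dp, opsAllZd_QQ, hDR, QQZdP_eq_zero_of_clsField_eq_zero τ ΛbP i m 1 hcls, DpZd_one]
    simp only [Pi.zero_apply, add_zero]
    exact Jcur_one_grad i.η lam τ' y
  have hΔ0 : ∀ (y : Site d) (τ' : Fin d), deltaAOf i.η (opsAllZd τ L ΛbP ops₀ M i m) 1 0 y τ' = 0 := by
    -- the zero field is the mode of the empty domain... simplest: it is `skewMode 0 x₀ x₀`-free; use linearity-free evaluation of each letter
    intro y τ'
    have hDR0 : ∀ (x : Site d) (μ : Fin d), (opsAllZd τ L ΛbP ops₀ M i m).DRDs 1 0 x μ = 0 :=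
      landauAt_opsAllZd τ L ΛbP ops₀ M i m (bg := bg) (mem := mem) (ιCfg := ιCfg) hτt hτs hτp c35 a₃ hΩ (K₆ * ε) 1 one_mem_unitaryUnits_cfg
        (mul_pos hK₆ hε) (hεP ε hε le_rfl).2 hreg 0 h0On
        (B9SupplySockB9P3ZdAtBoundaryMode.isLandau138_zero_field L m i.η (i.Ω 0) (i.Λs m) 1)
    have hcls0' : ∀ j, clsField L ΛbP i.η m j (1 : Site d → Fin d → 𝔸ˣ) (0 : Site d → Fin d → 𝔸) = 0 := by
      intro j; funext z κ
      simp only [clsField, Pi.zero_apply]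
      split_ifs
      · have : iEta i.η (0 : Site d → Fin d → 𝔸) = 0 := by funext y τ; simp [B8Eq146AExpansion.iEta_def]
        rw [this, B9SupplySockB9P3ZdAtBoundaryMode.linCovIter_zero_fun, Pi.zero_apply, Pi.zero_apply, smul_zero]
      · rfl
    rw [deltaAOf, opsAllZd_Dp, opsAllZd_QQ, hDR0, QQZdP_eq_zero_of_clsField_eq_zero τ ΛbP i m 1 hcls0', DpZd_one]
    simp only [Pi.zero_apply, add_zero]
    have : (0 : Site d → Fin d → 𝔸) = fun y κ => (fun _ : Site d => (0 : 𝔸)) (y + e κ) - (fun _ : Site d => (0 : 𝔸)) y := by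
      funext y κ; simp
    rw [this]; exact Jcur_one_grad i.η (fun _ => (0 : 𝔸)) τ' y
  have hA := hinv (K₆ * ε) 1 one_mem_unitaryUnits_cfg (mul_pos hK₆ hε) (hεP ε hε le_rfl).2 hreg g hgOn hg_sa 0 (fun y ν _ => by rw [hΔ]; rfl)
  have h0 := hinv (K₆ * ε) 1 one_mem_unitaryUnits_cfg (mul_pos hK₆ hε) (hεP ε hε le_rfl).2 hreg 0 h0On (fun _ _ => IsSelfAdjoint.zero _) 0
    (fun y ν _ => by rw [hΔ0]; rfl)
  have hg0 : g x₀ μ₀ = -1 := by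
    simp [hg, hlam, Set.indicator_of_mem hx₀, Set.indicator_of_notMem hx₁]
  have := congrFun (congrFun (hA.symm.trans h0) x₀) μ₀
  rw [hg0, Pi.zero_apply, Pi.zero_apply, neg_eq_zero] at this
  exact one_ne_zero this

/-- ★★★ **AT EVERY CUBE MEMBER OF (1.131) WITH THE TREE'S SPLIT CLASS `cubeLamBP'` (level `0` = inner bonds), `InvAtH` FOR THE FOUR-LETTER RECORD IS FALSE** at
EVERY truncation `m ≤ k` (`ρ ≥ max L 2`, `L ≥ 1`): the Hermitian boundary mode `d(𝟙_{□₀}·1)` — so on the cube road the genuine letter needs print's class WITH the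
crossing bonds at level `0` (`cubeLamBP`, n05-c) before Theorem 3.11 can hold at the member. [cite: Balaban1985RegularSpaces, (1.131) p.99, p.77 (bond convention), (1.68) p.88, Prop. 6 p.99; Balaban1985BackgroundPropagators, (3.16) p.393, (3.27) p.395, Thm 3.11 p.416; Balaban1984PropagatorsII, (2.3) p.224] -/
theorem cube_invAtH_opsAllZd_false_cubeLamBP' [NeZero L] [Nontrivial 𝔸] (hτt : ∀ a b : 𝔸, τ (a * b) = τ (b * a))
    (hτs : ∀ a : 𝔸, τ (star a) = starRingEnd ℂ (τ a)) (hτp : ∀ a : 𝔸, a ≠ 0 → 0 < (τ (star a * a)).re)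
    (hL : 1 ≤ L) (ops₀ : ℝ → ZdIdx d L → ℕ → OpsZd d 𝔸) {c35 c₆ K₆ a₃ M : ℝ} (hc₆ : 0 < c₆) (hK₆ : 0 < K₆) (ha₃ : 0 < a₃)
    (μ : Fin d) (i : ZdIdx d L) {a : Site d} {Mc ρ : ℕ} (hρ2 : 2 ≤ ρ) (hρL : L ≤ ρ)
    (hΩ : i.Ω = cubeFam false L a Mc ρ i.k) (hΛs : i.Λs = cubeLamS L a Mc ρ i.k) {m : ℕ} (hm : m ≤ i.k)
    (hP6 : Prop6At bg L mem ιCfg c35 c₆ K₆ M i m) :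
    ¬ InvAtH bg L mem ιCfg (opsAllZd τ L (cubeLamBP' L a Mc ρ i.k) ops₀) c35 a₃ M i m := by
  have hρ1 : 1 ≤ ρ := le_trans one_le_two hρ2
  have hΩ0 : i.Ω 0 = cube L a Mc ρ i.k 0 := by rw [hΩ, cubeFam_false_zero]
  have hfin : (i.Ω 0).Finite := by
    rw [hΩ0, cube_eq (Nat.zero_le _)]
    refine (Set.finite_Icc (bLo L a i.k (L ^ 0 * (ρ * gs L (i.k - 0)))) (bHi L a Mc i.k (L ^ 0 * (ρ * gs L (i.k - 0))))).subset
      fun x hx => ?_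
    exact ⟨fun n => (hx n).1, fun n => (hx n).2⟩
  obtain ⟨hx₀, hx₁⟩ := cube_corner_boundary_bond (i := i) hρ1 hΩ μ
  refine invAtH_opsAllZd_false_of_boundaryMode τ bg mem ιCfg hτt hτs hτp hL _ ops₀ hc₆ hK₆ ha₃ hfin (cube_deep hL hρ2 hΩ hΛs m) hx₀ hx₁
    (fun p hp => ?_) (fun j hj p hp x hx => ?_) hP6
  · -- level `0`: `cubeLamBP' … m 0 = cubeLamB … m 0`, both end-points in `Λ_s m 0 ⊆ □₀`
    rw [cubeLamBP'_zero] at hp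
    have hS : cubeLamS L a Mc ρ i.k m 0 ⊆ i.Ω 0 := by
      intro x hx
      rcases Nat.eq_zero_or_pos m with rfl | hm0
      · rw [B8CubeMemberZd.cubeLamS_self] at hx
        rw [hΩ0]
        simpa [cube, B8Ineq130.tlo_zero, B8Ineq130.thi_zero] using hx
      · rw [cubeLamS_of_lt L a Mc ρ i.k hm0, mem_cubeLam_zero_iff hL a Mc ρ i.hk] at hx
        rw [hΩ0]; exact hx.1
    exact ⟨hS (cubeLamB_zero_mem hp).1, hS (cubeLamB_zero_mem hp).2⟩
  · -- levels `j ≥ 1`: `cubeLamBP' … m j = cubeLamBP … m j`, box ⊂ `□_{j−1} ⊆ □₀`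
    rw [cubeLamBP'_of_ne_zero L a Mc ρ i.k m (by omega)] at hp
    have hjk : j ≤ i.k := (hp.1).trans hm
    rw [hΩ0]
    exact cube_anti (Nat.zero_le _) (by omega) (cubeLamBP_box_subset_pred hL a Mc hρL hj hm hp x hx)

end BoundaryMode

end Literature.MathematicalPhysics.QuantumFieldTheory.Balaban1983to89.B9SupplySockB9P3ZdSkewGaugeModeCube

end
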